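import Summits.Ventures.Crystal3D.Theorems.StickyWulffConstantCoaxialWallLawBarlowOneFccPayers
import Summits.Ventures.Crystal3D.Theorems.StickyWulffConstantCoaxialWallLawBarlowOneFccExportB
import Summits.Ventures.Crystal3D.Theorems.StickyWulffConstantCoaxialWallLawOneFccMirrorTransport
import Summits.Ventures.Crystal3D.Theorems.StickyWulffConstantCoaxialWallLawOneFccTwoFamilyRow
import HarnessLib

/-!
# The ONE-FCC F_layer cell, BOTH FAMILIES, in lane T's payer currency (file (g) of the two-family ledger)

HONEST FRAMING. Venture `Summits/Ventures/Crystal3D` (cell `crystal3d-full`); helper `--supports` the crux `CoaxialWallLaw`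
(stmt-Ventures-19481, REGISTERED line `WallLedgerF`) in its role as owner of lane T's debt T-F2 / F_layer, OneFcc half (cf-p1 (civ)/(cxx)
«OneFcc = TWO FAMILIES»; memo HOME/wall-19481-p1/g16/TWO-FAMILY-LEDGER-g16.md).  Inputs `KissingGap δ`, `KissingClassification δ` and the
TWIN ROW (`LocalEndRowA` at the root frame, the shape of `EndRowTwinHalfTurnA … Fr`) BY NAME; census-free; standard axioms; nothing about
the crux is claimed; F-C1 not moved.

THE CELL (case II of the OneFcc F_layer): bottom plate `F = stacking L₁ s₁ σ₁` (any Hägg word), top plate `C = stacking L₂ s₂ σ₂`,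
`σ₂ ≡ ε`, FULL in `Gf`; `Fr ∈ {L₁, basalMirror ≫ L₁}` (sign `t`) is the root frame of FAMILY A (`wordNet_barlow_endPairs_oneFcc`: F's
tree of the dozen opposite to `Fr`, run into `C`, `Gf '' D = Fr '' (basalMirror '' D)`).  FAMILY B is `wordNet_barlow_endPairs_oneFccB` in
the MIRRORED cell `M(X)`, `M p = basalMirror p + h e₃` (bottom `M(C) = stacking (L₂ ≫ bM) (M s₂) σ₂`, top `M(F) = stacking (L₁ ≫ bM) (M s₁) σ₁`),
rooted at `FrB = (H ≫ Fr) ≫ basalMirror` (`H` the half-turn about `e₃`; `FrB = G₀ ≫ (L₁ ≫ bM)` with the standard pair `G₀ = H` resp. `−1`,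
carrying `M(C)`'s dozen; twin top frame `Gt = Fr ≫ bM` of sign `t`), pulled back to `X` by `endPairs_pullback_mirror` and pooled with family A
under the twin row at `Fr` by `twoFamily_endPairs_le_row`; the widened payer window and the four rim annuli are converted to lane T's
currency exactly as in `oneFcc_rawSources_le_payerSum` (…BarlowOneFccPayers).
**`oneFcc_twoFamily_sources_le_payerSum`** — `srcA + srcB − exitB ≤ sF · Σ_{PAY} (12 − deg) + (3456 sF + 1710720) ρ`, where `srcA` = the
A-admissible bottom-core balls crossing into the window (summed over the rising in-plane roots of `Fr`), `srcB` = ALL core balls of `M(C)`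
crossing into the mirrored window (roots of `FrB`), `exitB` = the mirrored top-band balls of `M(F)` on layers of type `≠ (t, t)` whose
`r`-predecessor lies below the band, `PAY = {y ∈ X : deg y ≠ 12, −R₀−2 ≤ y₂ ≤ h+R₀+2}`.
WHAT THIS IS NOT: the flux bounds for `srcA`, `srcB`, `exitB` and the charge (files (h), (i)) and the final `BilayerWallAt`; F-C1 not moved.
-/

noncomputable section

namespace Summit.Ventures.Crystal3D.Theorems

open Summit.Ventures.Crystal3D Finset
open Literature.MathematicalPhysics.StatisticalMechanics (barlowPos barlowStacking IsHaggSeq basalMirror basalMirror_apply_coord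
  basalMirror_basalMirror)
open Summit.Ventures.Crystal3D.Cruxes.TextureLiminf.TexShadow (E3 stacking)
open scoped InnerProductSpace

open scoped Classical in
/-- **The widened payer window in lane T's currency**: `Σ_{deg ≤ 11, −R₀−3 ≤ z₂ ≤ h+R₀+3} (12 − deg) ≤ Σ_{PAY} (12 − deg) + 3456 ρ`
(the two extra bands are rim balls, `extraPayers_card_le₁/₂`, each worth `≤ 12`). -/
theorem widePayers_le_payerSum {σ₁ σ₂ : ℤ → ℤ} (hσ₁ : IsHaggSeq σ₁) (hσ₂ : IsHaggSeq σ₂) (L₁ L₂ : E3 ≃ₗᵢ[ℝ] E3) (s₁ s₂ : E3)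
    (X P₁ P₂ : Finset E3) (R₀ h ρ : ℝ) (hR₀ : 4 ≤ R₀) (hρ : 3 ≤ ρ)
    (hX : ∀ p ∈ X, ∀ q ∈ X, p ≠ q → 1 ≤ dist p q) (hP₁X : P₁ ⊆ X) (hP₂X : P₂ ⊆ X)
    (hcell : ∀ p ∈ X, -(2 * R₀) ≤ p 2 ∧ p 2 ≤ h + 2 * R₀ ∧ p 0 ^ 2 + p 1 ^ 2 ≤ ρ ^ 2)
    (hP₁ : ∀ p, p ∈ P₁ ↔ (p ∈ stacking L₁ s₁ σ₁ ∧ -(2 * R₀) ≤ p 2 ∧ p 2 ≤ -R₀ ∧ p 0 ^ 2 + p 1 ^ 2 ≤ ρ ^ 2))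
    (hP₂ : ∀ p, p ∈ P₂ ↔ (p ∈ stacking L₂ s₂ σ₂ ∧ h + R₀ ≤ p 2 ∧ p 2 ≤ h + 2 * R₀ ∧ p 0 ^ 2 + p 1 ^ 2 ≤ ρ ^ 2)) :
    ∑ z ∈ X.filter (fun z => (X.filter fun q => dist z q = 1).card ≤ 11 ∧ -R₀ - 2 - 1 ≤ z 2 ∧ z 2 ≤ h + R₀ + 2 + 1),
        ((12 : ℝ) - ((X.filter fun q => dist z q = 1).card : ℝ)) ≤
      ∑ y ∈ X.filter (fun y => (X.filter fun q => dist y q = 1).card ≠ 12 ∧ -R₀ - 2 ≤ y 2 ∧ y 2 ≤ h + R₀ + 2),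
          ((12 : ℝ) - ((X.filter fun q => dist y q = 1).card : ℝ)) + 3456 * ρ := by
  set deg : E3 → ℕ := fun z => (X.filter fun q => dist z q = 1).card with hdeg
  set f : E3 → ℝ := fun z => (12 : ℝ) - (deg z : ℝ) with hf
  set PAYW := X.filter (fun z => deg z ≤ 11 ∧ -R₀ - 2 - 1 ≤ z 2 ∧ z 2 ≤ h + R₀ + 2 + 1) with hPAYW
  set PAY := X.filter (fun y => deg y ≠ 12 ∧ -R₀ - 2 ≤ y 2 ∧ y 2 ≤ h + R₀ + 2) with hPAY
  set EX₁ := X.filter (fun z => deg z ≤ 11 ∧ -(R₀ + 1) - 2 ≤ z 2 ∧ z 2 < -R₀ - 2) with hEX₁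
  set EX₂ := X.filter (fun z => deg z ≤ 11 ∧ h + R₀ + 2 < z 2 ∧ z 2 ≤ h + (R₀ + 1) + 2) with hEX₂
  have hdeg12 : ∀ z, deg z ≤ 12 := fun z => card_filter_dist_eq_one_le_twelve X hX z
  have hf12 : ∀ z, f z ≤ 12 := fun z => by
    have : (0 : ℝ) ≤ (deg z : ℝ) := Nat.cast_nonneg _
    simp only [hf]; linarith
  have hfnn : ∀ z, deg z ≠ 12 → 0 ≤ f z := fun z hz => by
    have h12 : deg z ≤ 11 := by have := hdeg12 z; omega
    have : (deg z : ℝ) ≤ 11 := by exact_mod_cast h12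
    simp only [hf]; linarith
  have hsplit := (sum_filter_add_sum_filter_not PAYW (fun z => -R₀ - 2 ≤ z 2 ∧ z 2 ≤ h + R₀ + 2) f).symm
  have hmid : ∑ z ∈ PAYW.filter (fun z => -R₀ - 2 ≤ z 2 ∧ z 2 ≤ h + R₀ + 2), f z ≤ ∑ y ∈ PAY, f y := by
    refine sum_le_sum_of_subset_of_nonneg (fun z hz => ?_) (fun y hy _ => hfnn y (mem_filter.1 hy).2.1)
    obtain ⟨hzW, h1, h2⟩ := mem_filter.1 hz
    obtain ⟨hzX, hz11, -, -⟩ := mem_filter.1 hzW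
    exact mem_filter.2 ⟨hzX, by omega, h1, h2⟩
  have hout : ∑ z ∈ PAYW.filter (fun z => ¬ (-R₀ - 2 ≤ z 2 ∧ z 2 ≤ h + R₀ + 2)), f z ≤ 12 * ((EX₁.card : ℝ) + EX₂.card) := by
    have hsub : PAYW.filter (fun z => ¬ (-R₀ - 2 ≤ z 2 ∧ z 2 ≤ h + R₀ + 2)) ⊆ EX₁ ∪ EX₂ := by
      intro z hz
      obtain ⟨hzW, hnot⟩ := mem_filter.1 hz
      obtain ⟨hzX, hz11, h1, h2⟩ := mem_filter.1 hzW
      rw [mem_union]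
      by_cases hlo : z 2 < -R₀ - 2
      · exact Or.inl (mem_filter.2 ⟨hzX, hz11, by linarith, hlo⟩)
      · push Not at hlo
        have hhi : h + R₀ + 2 < z 2 := by
          by_contra hle; push Not at hle; exact hnot ⟨hlo, hle⟩
        exact Or.inr (mem_filter.2 ⟨hzX, hz11, hhi, by linarith⟩)
    calc ∑ z ∈ PAYW.filter (fun z => ¬ (-R₀ - 2 ≤ z 2 ∧ z 2 ≤ h + R₀ + 2)), f z
        ≤ ∑ z ∈ PAYW.filter (fun z => ¬ (-R₀ - 2 ≤ z 2 ∧ z 2 ≤ h + R₀ + 2)), (12 : ℝ) := sum_le_sum fun z _ => hf12 z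
      _ = 12 * ((PAYW.filter (fun z => ¬ (-R₀ - 2 ≤ z 2 ∧ z 2 ≤ h + R₀ + 2))).card : ℝ) := by
          rw [sum_const, nsmul_eq_mul, mul_comm]
      _ ≤ 12 * ((EX₁.card : ℝ) + EX₂.card) := by
          have h1 := card_le_card hsub
          have h2 := card_union_le EX₁ EX₂
          have : ((PAYW.filter (fun z => ¬ (-R₀ - 2 ≤ z 2 ∧ z 2 ≤ h + R₀ + 2))).card : ℝ) ≤ (EX₁.card : ℝ) + EX₂.card := by
            exact_mod_cast h1.trans h2
          linarith
  have hEX₁ : (EX₁.card : ℝ) ≤ 144 * ρ := extraPayers_card_le₁ hσ₁ L₁ s₁ hX hP₁X hcell hP₁ hR₀ hρ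
  have hEX₂ : (EX₂.card : ℝ) ≤ 144 * ρ := extraPayers_card_le₂ hσ₂ L₂ s₂ hX hP₂X hcell hP₂ hR₀ hρ
  rw [hsplit]; nlinarith [hmid, hout, hEX₁, hEX₂]

/-- **The two rim annuli of a clamped cell hold `≤ 180 ρ` (top) and `≤ 144 ρ` (bottom) balls** (`card_mul_le_of_separated_in_shell`). -/
theorem rims_card_le (Y : Finset E3) (R₀ h ρ : ℝ) (hR₀ : 5 ≤ R₀) (hρ : R₀ + 2 ≤ ρ)
    (hY : ∀ p ∈ Y, ∀ q ∈ Y, p ≠ q → 1 ≤ dist p q)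
    (hYcell : ∀ p ∈ Y, -(2 * R₀) ≤ p 2 ∧ p 2 ≤ h + 2 * R₀ ∧ p 0 ^ 2 + p 1 ^ 2 ≤ ρ ^ 2) :
    ((Y.filter fun s => h + (R₀ + 1) + 1 ≤ s 2 ∧ s 2 ≤ h + (R₀ + 1) + 1 + 1 ∧ (ρ - 1 - 2) ^ 2 < s 0 ^ 2 + s 1 ^ 2).card : ℝ)
        ≤ 180 * ρ ∧
    ((Y.filter fun s => -(R₀ + 1) - 1 - 1 ≤ s 2 ∧ s 2 < -(R₀ + 1) - 1 ∧ (ρ - 1 - 1) ^ 2 < s 0 ^ 2 + s 1 ^ 2).card : ℝ)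
        ≤ 144 * ρ := by
  constructor
  · set RIM := Y.filter (fun s => h + (R₀ + 1) + 1 ≤ s 2 ∧ s 2 ≤ h + (R₀ + 1) + 1 + 1 ∧ (ρ - 1 - 2) ^ 2 < s 0 ^ 2 + s 1 ^ 2)
      with hRIM
    have hsep : ∀ p ∈ RIM, ∀ q ∈ RIM, p ≠ q → 1 ≤ dist p q :=
      fun p hp q hq hpq => hY p (mem_filter.1 hp).1 q (mem_filter.1 hq).1 hpq
    have hmem : ∀ p ∈ RIM, h + (R₀ + 1) + 1 ≤ p 2 ∧ p 2 ≤ h + (R₀ + 1) + 1 + 1 ∧ (ρ - 1 - 2) ^ 2 < p 0 ^ 2 + p 1 ^ 2 ∧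
        p 0 ^ 2 + p 1 ^ 2 ≤ ρ ^ 2 := by
      intro p hp
      obtain ⟨hpX, h1, h2, h3⟩ := mem_filter.1 hp
      exact ⟨h1, h2, h3, (hYcell p hpX).2.2⟩
    have key := card_mul_le_of_separated_in_shell RIM hsep (h + (R₀ + 1) + 1) (h + (R₀ + 1) + 1 + 1) (ρ - 1 - 2) ρ
      (by linarith) (by linarith) (by linarith) hmem
    have e : (h + (R₀ + 1) + 1 + 1 - (h + (R₀ + 1) + 1) + 2) * (Real.pi * (ρ + 1) ^ 2 - Real.pi * (ρ - 1 - 2 - 1) ^ 2) =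
        (Real.pi / 6) * (180 * ρ - 270) := by ring
    rw [e] at key
    have hπ : 0 < Real.pi / 6 := by positivity
    have := le_of_mul_le_mul_right (by linarith [key] : (RIM.card : ℝ) * (Real.pi / 6) ≤ (180 * ρ - 270) * (Real.pi / 6)) hπ
    linarith
  · set RIM := Y.filter (fun s => -(R₀ + 1) - 1 - 1 ≤ s 2 ∧ s 2 < -(R₀ + 1) - 1 ∧ (ρ - 1 - 1) ^ 2 < s 0 ^ 2 + s 1 ^ 2)
      with hRIM
    have hsep : ∀ p ∈ RIM, ∀ q ∈ RIM, p ≠ q → 1 ≤ dist p q :=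
      fun p hp q hq hpq => hY p (mem_filter.1 hp).1 q (mem_filter.1 hq).1 hpq
    have hmem : ∀ p ∈ RIM, -(R₀ + 1) - 1 - 1 ≤ p 2 ∧ p 2 ≤ -(R₀ + 1) - 1 ∧ (ρ - 1 - 1) ^ 2 < p 0 ^ 2 + p 1 ^ 2 ∧
        p 0 ^ 2 + p 1 ^ 2 ≤ ρ ^ 2 := by
      intro p hp
      obtain ⟨hpX, h1, h2, h3⟩ := mem_filter.1 hp
      exact ⟨h1, h2.le, h3, (hYcell p hpX).2.2⟩
    have key := card_mul_le_of_separated_in_shell RIM hsep (-(R₀ + 1) - 1 - 1) (-(R₀ + 1) - 1) (ρ - 1 - 1) ρ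
      (by linarith) (by linarith) (by linarith) hmem
    have e : (-(R₀ + 1) - 1 - (-(R₀ + 1) - 1 - 1) + 2) * (Real.pi * (ρ + 1) ^ 2 - Real.pi * (ρ - 1 - 1 - 1) ^ 2) =
        (Real.pi / 6) * (144 * ρ - 144) := by ring
    rw [e] at key
    have hπ : 0 < Real.pi / 6 := by positivity
    have := le_of_mul_le_mul_right (by linarith [key] : (RIM.card : ℝ) * (Real.pi / 6) ≤ (144 * ρ - 144) * (Real.pi / 6)) hπ
    linarith

open scoped Classical in
/-- **The ONE-FCC cell, both families, in lane T's payer currency.**  See the module docstring. -/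
theorem oneFcc_twoFamily_sources_le_payerSum (ver : WordVersion) {δ : ℝ} (hg : KissingGap δ) (hc : KissingClassification δ)
    {σ₁ σ₂ : ℤ → ℤ} (hσ₁ : IsHaggSeq σ₁) (L₁ L₂ : E3 ≃ₗᵢ[ℝ] E3) (s₁ s₂ : E3)
    (Fr : E3 ≃ₗᵢ[ℝ] E3) {t : ℤ} (hFr : (t = 1 ∧ Fr = L₁) ∨ (t = -1 ∧ Fr = basalMirror.trans L₁))
    (Gf : E3 ≃ₗᵢ[ℝ] E3) {ε : ℤ} (hGf : (ε = 1 ∧ Gf = L₂) ∨ (ε = -1 ∧ Gf = basalMirror.trans L₂))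
    (hσ₂ : ∀ n : ℤ, σ₂ n = ε)
    (hdozen : (Gf : E3 → E3) '' ↑fccSlots = (fun x => Fr (basalMirror x)) '' ↑fccSlots)
    (FrB : E3 ≃ₗᵢ[ℝ] E3)
    (hFrB : FrB = ((((ℝ ∙ EuclideanSpace.single (2 : Fin 3) (1 : ℝ)).reflection).trans Fr).trans basalMirror))
    {sF : ℝ} (hsF : 0 ≤ sF)
    (hrow : LocalEndRowA ver sF ⟨Fr, inPlaneRoots Fr 1⟩
      ⟨((ℝ ∙ EuclideanSpace.single (2 : Fin 3) (1 : ℝ)).reflection).trans Fr,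
        inPlaneRoots (((ℝ ∙ EuclideanSpace.single (2 : Fin 3) (1 : ℝ)).reflection).trans Fr) (-1)⟩)
    (X P₁ P₂ : Finset E3) (R₀ h ρ : ℝ) (hR₀ : 5 ≤ R₀) (hρ : R₀ + 2 ≤ ρ)
    (hX : ∀ p ∈ X, ∀ q ∈ X, p ≠ q → 1 ≤ dist p q) (hP₁X : P₁ ⊆ X) (hP₂X : P₂ ⊆ X)
    (hcell : ∀ p ∈ X, -(2 * R₀) ≤ p 2 ∧ p 2 ≤ h + 2 * R₀ ∧ p 0 ^ 2 + p 1 ^ 2 ≤ ρ ^ 2)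
    (hP₁ : ∀ p, p ∈ P₁ ↔ (p ∈ stacking L₁ s₁ σ₁ ∧ -(2 * R₀) ≤ p 2 ∧ p 2 ≤ -R₀ ∧ p 0 ^ 2 + p 1 ^ 2 ≤ ρ ^ 2))
    (hP₂ : ∀ p, p ∈ P₂ ↔ (p ∈ stacking L₂ s₂ σ₂ ∧ h + R₀ ≤ p 2 ∧ p 2 ≤ h + 2 * R₀ ∧ p 0 ^ 2 + p 1 ^ 2 ≤ ρ ^ 2)) :
    ((∑ r ∈ inPlaneRoots Fr 1,
        ((P₁.filter fun p => -(R₀ + 1) - 1 - 1 ≤ p 2 ∧ p 2 ≤ -(R₀ + 1) - 1 ∧ p 0 ^ 2 + p 1 ^ 2 ≤ (ρ - 1 - 1) ^ 2).filter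
          fun p => (∃ k i j : ℤ, p = L₁ (barlowPos 1 (Real.sqrt (2 / 3)) σ₁ k i j) + s₁ ∧ ¬ (σ₁ (k - 1) = -t ∧ σ₁ k = -t)) ∧
            -(R₀ + 1) - 1 < (p + Fr r) 2 ∧ (p + Fr r) 2 < h + (R₀ + 1) + 1).card : ℕ) : ℝ) +
      ((∑ r ∈ inPlaneRoots FrB 1,
        (((P₂.image fun p => basalMirror p + h • EuclideanSpace.single (2 : Fin 3) (1 : ℝ)).filter fun p =>
            -(R₀ + 1) - 1 - 1 ≤ p 2 ∧ p 2 ≤ -(R₀ + 1) - 1 ∧ p 0 ^ 2 + p 1 ^ 2 ≤ (ρ - 1 - 1) ^ 2).filter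
          fun p => -(R₀ + 1) - 1 < (p + FrB r) 2 ∧ (p + FrB r) 2 < h + (R₀ + 1) + 1).card : ℕ) : ℝ) -
      ((∑ r ∈ inPlaneRoots FrB 1,
        ((X.image fun p => basalMirror p + h • EuclideanSpace.single (2 : Fin 3) (1 : ℝ)).filter fun b =>
          h + (R₀ + 1) + 1 ≤ b 2 ∧ b 2 ≤ h + (R₀ + 1) + 1 + 1 ∧ b 0 ^ 2 + b 1 ^ 2 ≤ (ρ - 1 - 2) ^ 2 ∧
          (b - FrB r) 2 < h + (R₀ + 1) + 1 ∧
          ∃ k i j : ℤ, b = (L₁.trans basalMirror) (barlowPos 1 (Real.sqrt (2 / 3)) σ₁ k i j) +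
              (basalMirror s₁ + h • EuclideanSpace.single (2 : Fin 3) (1 : ℝ)) ∧
            ¬ (σ₁ (k - 1) = t ∧ σ₁ k = t)).card : ℕ) : ℝ) ≤
      sF * ∑ y ∈ X.filter (fun y => (X.filter fun q => dist y q = 1).card ≠ 12 ∧ -R₀ - 2 ≤ y 2 ∧ y 2 ≤ h + R₀ + 2),
          ((12 : ℝ) - ((X.filter fun q => dist y q = 1).card : ℝ)) +
        (3456 * sF + 1710720) * ρ := by
  have hε : ε = 1 ∨ ε = -1 := by
    rcases hGf with ⟨h1, -⟩ | ⟨h1, -⟩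
    · exact Or.inl h1
    · exact Or.inr h1
  have hσ₂H : IsHaggSeq σ₂ := fun n => by rw [hσ₂ n]; exact hε
  -- ### the cell mirror `M`
  set H : E3 ≃ₗᵢ[ℝ] E3 := (ℝ ∙ EuclideanSpace.single (2 : Fin 3) (1 : ℝ)).reflection with hH
  set cM : E3 := h • EuclideanSpace.single (2 : Fin 3) (1 : ℝ) with hcM
  have hc0 : cM 0 = 0 := by simp [hcM]
  have hc1 : cM 1 = 0 := by simp [hcM]
  have hc2 : cM 2 = h := by simp [hcM]
  have hbM : ∀ (v : E3), basalMirror v 0 = v 0 ∧ basalMirror v 1 = v 1 ∧ basalMirror v 2 = -v 2 := fun v =>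
    ⟨by rw [basalMirror_apply_coord]; exact if_neg (by decide), by rw [basalMirror_apply_coord]; exact if_neg (by decide),
      by rw [basalMirror_apply_coord, if_pos rfl]⟩
  have hcMmirror : basalMirror cM = -cM := by
    ext l
    rw [PiLp.neg_apply]
    fin_cases l
    · simp only [Fin.zero_eta, Fin.isValue]; rw [(hbM cM).1, hc0, neg_zero]
    · simp only [Fin.mk_one, Fin.isValue]; rw [(hbM cM).2.1, hc1, neg_zero]
    · simp only [Fin.reduceFinMk, Fin.isValue]; rw [(hbM cM).2.2]
  set M : E3 → E3 := fun p => basalMirror p + cM with hM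
  have hM0 : ∀ p, M p 0 = p 0 := by intro p; simp only [hM, PiLp.add_apply, (hbM p).1, hc0, add_zero]
  have hM1 : ∀ p, M p 1 = p 1 := by intro p; simp only [hM, PiLp.add_apply, (hbM p).2.1, hc1, add_zero]
  have hM2 : ∀ p, M p 2 = h - p 2 := by intro p; simp only [hM, PiLp.add_apply, (hbM p).2.2, hc2]; ring
  have hMM : ∀ p, M (M p) = p := by
    intro p; simp only [hM, map_add, basalMirror_basalMirror, hcMmirror]; abel
  have hMinj : Function.Injective M := fun p q hpq => by
    have := congrArg M hpq; rwa [hMM, hMM] at this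
  have hMdist : ∀ p q, dist (M p) (M q) = dist p q := by
    intro p q; simp only [hM, dist_add_right, LinearIsometryEquiv.dist_map]
  have hMrad : ∀ p, M p 0 ^ 2 + M p 1 ^ 2 = p 0 ^ 2 + p 1 ^ 2 := by intro p; rw [hM0, hM1]
  have hmemIm : ∀ (Q : Finset E3) p, p ∈ Q.image M ↔ M p ∈ Q := by
    intro Q p
    rw [mem_image]
    constructor
    · rintro ⟨x, hx, hxp⟩; rw [← hxp, hMM]; exact hx
    · intro hp; exact ⟨M p, hp, hMM p⟩
  set X' := X.image M with hX'
  have hX'sep : ∀ p ∈ X', ∀ q ∈ X', p ≠ q → 1 ≤ dist p q := by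
    intro p hp q hq hpq
    rw [← hMdist]
    exact hX _ ((hmemIm X p).1 hp) _ ((hmemIm X q).1 hq) (fun h' => hpq (hMinj h'))
  have hcell' : ∀ p ∈ X', -(2 * R₀) ≤ p 2 ∧ p 2 ≤ h + 2 * R₀ ∧ p 0 ^ 2 + p 1 ^ 2 ≤ ρ ^ 2 := by
    intro p hp
    obtain ⟨h1, h2, h3⟩ := hcell _ ((hmemIm X p).1 hp)
    rw [hM2] at h1 h2; rw [hMrad] at h3
    exact ⟨by linarith, by linarith, h3⟩
  have hstack : ∀ (L : E3 ≃ₗᵢ[ℝ] E3) (s : E3) (σ : ℤ → ℤ) (p : E3),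
      M p ∈ stacking L s σ ↔ p ∈ stacking (L.trans basalMirror) (basalMirror s + cM) σ := by
    intro L s σ p
    simp only [stacking, Set.mem_image, LinearIsometryEquiv.trans_apply]
    constructor
    · rintro ⟨r, hr, hrp⟩
      refine ⟨r, hr, ?_⟩
      have h1 := congrArg M hrp
      rw [hMM] at h1
      rw [← h1]; simp only [hM, map_add]; abel
    · rintro ⟨r, hr, rfl⟩
      refine ⟨r, hr, ?_⟩
      simp only [hM, map_add, basalMirror_basalMirror, hcMmirror]; abel
  have hP₁' : ∀ p, p ∈ P₂.image M ↔ (p ∈ stacking (L₂.trans basalMirror) (basalMirror s₂ + cM) σ₂ ∧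
      -(2 * R₀) ≤ p 2 ∧ p 2 ≤ -R₀ ∧ p 0 ^ 2 + p 1 ^ 2 ≤ ρ ^ 2) := by
    intro p
    rw [hmemIm, hP₂, hM2, hMrad, hstack]
    constructor
    · rintro ⟨h1, h2, h3, h4⟩; exact ⟨h1, by linarith, by linarith, h4⟩
    · rintro ⟨h1, h2, h3, h4⟩; exact ⟨h1, by linarith, by linarith, h4⟩
  have hP₂' : ∀ p, p ∈ P₁.image M ↔ (p ∈ stacking (L₁.trans basalMirror) (basalMirror s₁ + cM) σ₁ ∧
      h + R₀ ≤ p 2 ∧ p 2 ≤ h + 2 * R₀ ∧ p 0 ^ 2 + p 1 ^ 2 ≤ ρ ^ 2) := by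
    intro p
    rw [hmemIm, hP₁, hM2, hMrad, hstack]
    constructor
    · rintro ⟨h1, h2, h3, h4⟩; exact ⟨h1, by linarith, by linarith, h4⟩
    · rintro ⟨h1, h2, h3, h4⟩; exact ⟨h1, by linarith, by linarith, h4⟩
  have hP₁'X : P₂.image M ⊆ X' := image_subset_image hP₂X
  have hP₂'X : P₁.image M ⊆ X' := image_subset_image hP₁X
  -- ### the frames of family B
  have hHneg : ∀ x : E3, H x = -basalMirror x := by
    intro x
    obtain ⟨h0, h1, h2⟩ := halfTurn_coord x
    ext l
    rw [PiLp.neg_apply]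
    fin_cases l
    · simp only [Fin.zero_eta, Fin.isValue]; rw [hH, h0, (hbM x).1]
    · simp only [Fin.mk_one, Fin.isValue]; rw [hH, h1, (hbM x).2.1]
    · simp only [Fin.reduceFinMk, Fin.isValue]; rw [hH, h2, (hbM x).2.2, neg_neg]
  have hnegD : (fun w : E3 => -w) '' (↑fccSlots : Set E3) = ↑fccSlots := by
    ext y
    constructor
    · rintro ⟨w, hw, rfl⟩; exact Finset.mem_coe.2 (neg_mem_fccSlots (Finset.mem_coe.1 hw))
    · intro hy; exact ⟨-y, Finset.mem_coe.2 (neg_mem_fccSlots (Finset.mem_coe.1 hy)), neg_neg y⟩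
  have hHfun : (H : E3 → E3) = basalMirror ∘ fun w : E3 => -w :=
    funext fun x => by rw [Function.comp_apply, map_neg, hHneg]
  have hHD : (H : E3 → E3) '' ↑fccSlots = (basalMirror : E3 → E3) '' ↑fccSlots := by
    rw [hHfun, Set.image_comp, hnegD]
  have hbHfun : ((basalMirror.trans H : E3 ≃ₗᵢ[ℝ] E3) : E3 → E3) = fun w : E3 => -w :=
    funext fun x => by rw [LinearIsometryEquiv.coe_trans, Function.comp_apply, hHneg, basalMirror_basalMirror]
  have hbHD : ((basalMirror.trans H : E3 ≃ₗᵢ[ℝ] E3) : E3 → E3) '' ↑fccSlots = ↑fccSlots := by rw [hbHfun, hnegD]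
  have hHbfun : ((H.trans basalMirror : E3 ≃ₗᵢ[ℝ] E3) : E3 → E3) = fun w : E3 => -w :=
    funext fun x => by rw [LinearIsometryEquiv.coe_trans, Function.comp_apply, hHneg, map_neg, basalMirror_basalMirror]
  have hHbD : ((H.trans basalMirror : E3 ≃ₗᵢ[ℝ] E3) : E3 → E3) '' ↑fccSlots = ↑fccSlots := by rw [hHbfun, hnegD]
  have hbHbfun : ((basalMirror.trans (H.trans basalMirror) : E3 ≃ₗᵢ[ℝ] E3) : E3 → E3) = basalMirror ∘ fun w : E3 => -w :=
    funext fun x => by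
      rw [LinearIsometryEquiv.coe_trans, Function.comp_apply, Function.comp_apply, map_neg,
        show (H.trans basalMirror) (basalMirror x) = -basalMirror x from congrFun hHbfun (basalMirror x)]
  have hbHbD : ((basalMirror.trans (H.trans basalMirror) : E3 ≃ₗᵢ[ℝ] E3) : E3 → E3) '' ↑fccSlots =
      (basalMirror : E3 → E3) '' ↑fccSlots := by rw [hbHbfun, Set.image_comp, hnegD]
  -- the standard pair `G₀`, the root frame `FrB = G₀ ≫ (L₁ ≫ bM)`, the twin top frame `Gt = Fr ≫ bM`
  obtain ⟨G₀, hG₀std, hFrB', hGt'⟩ : ∃ G₀ : E3 ≃ₗᵢ[ℝ] E3,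
      (((G₀ : E3 → E3) '' ↑fccSlots = ↑fccSlots ∧
          ((basalMirror.trans G₀ : E3 ≃ₗᵢ[ℝ] E3) : E3 → E3) '' ↑fccSlots = (basalMirror : E3 → E3) '' ↑fccSlots) ∨
        ((G₀ : E3 → E3) '' ↑fccSlots = (basalMirror : E3 → E3) '' ↑fccSlots ∧
          ((basalMirror.trans G₀ : E3 ≃ₗᵢ[ℝ] E3) : E3 → E3) '' ↑fccSlots = ↑fccSlots)) ∧
      FrB = G₀.trans (L₁.trans basalMirror) ∧
      ((t = 1 ∧ Fr.trans basalMirror = L₁.trans basalMirror) ∨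
        (t = -1 ∧ Fr.trans basalMirror = basalMirror.trans (L₁.trans basalMirror))) := by
    rcases hFr with ⟨ht, hFrL⟩ | ⟨ht, hFrL⟩
    · refine ⟨H, Or.inr ⟨hHD, hbHD⟩, ?_, Or.inl ⟨ht, by rw [hFrL]⟩⟩
      rw [hFrB, hFrL]; exact LinearIsometryEquiv.ext fun x => rfl
    · refine ⟨H.trans basalMirror, Or.inl ⟨hHbD, hbHbD⟩, ?_, Or.inr ⟨ht, ?_⟩⟩
      · rw [hFrB, hFrL]; exact LinearIsometryEquiv.ext fun x => rfl
      · rw [hFrL]; exact LinearIsometryEquiv.ext fun x => rfl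
  have hGf' : (ε = 1 ∧ Gf.trans basalMirror = L₂.trans basalMirror) ∨
      (ε = -1 ∧ Gf.trans basalMirror = basalMirror.trans (L₂.trans basalMirror)) := by
    rcases hGf with ⟨h1, h2⟩ | ⟨h1, h2⟩
    · exact Or.inl ⟨h1, by rw [h2]⟩
    · exact Or.inr ⟨h1, by rw [h2]; exact LinearIsometryEquiv.ext fun x => rfl⟩
  have hdozen' : (FrB : E3 → E3) '' ↑fccSlots = ((Gf.trans basalMirror : E3 ≃ₗᵢ[ℝ] E3) : E3 → E3) '' ↑fccSlots := by
    have e1 : (FrB : E3 → E3) = basalMirror ∘ (Fr ∘ H) := by rw [hFrB]; rfl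
    have e2 : ((Gf.trans basalMirror : E3 ≃ₗᵢ[ℝ] E3) : E3 → E3) = basalMirror ∘ Gf := rfl
    have e3 : (fun x => Fr (basalMirror x)) = Fr ∘ basalMirror := rfl
    rw [e1, e2, Set.image_comp, Set.image_comp, Set.image_comp, hHD, hdozen, e3, Set.image_comp]
  have htwin' : ((Fr.trans basalMirror : E3 ≃ₗᵢ[ℝ] E3) : E3 → E3) '' ↑fccSlots = (fun x => FrB (basalMirror x)) '' ↑fccSlots := by
    have e1 : ((Fr.trans basalMirror : E3 ≃ₗᵢ[ℝ] E3) : E3 → E3) = basalMirror ∘ Fr := rfl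
    have e2 : (fun x => FrB (basalMirror x)) = basalMirror ∘ (Fr ∘ fun w : E3 => -w) := funext fun x => by
      rw [hFrB]
      show basalMirror (Fr (H (basalMirror x))) = basalMirror (Fr (-x))
      rw [hHneg, basalMirror_basalMirror]
    rw [e1, e2, Set.image_comp, Set.image_comp, Set.image_comp, hnegD]
  -- ### the four rim annuli (two of `X`, two of the mirrored cell `X'`) and the root counts
  obtain ⟨hrimT, hrimB⟩ := rims_card_le X R₀ h ρ hR₀ hρ hX hcell
  obtain ⟨hrimT', hrimB'⟩ := rims_card_le X' R₀ h ρ hR₀ hρ hX'sep hcell'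
  have hRT12 : ∀ (G : E3 ≃ₗᵢ[ℝ] E3), ((inPlaneRoots G 1).card : ℝ) ≤ 12 := fun G => by
    have : (inPlaneRoots G 1).card ≤ 12 := (card_le_card (filter_subset _ _)).trans (by rw [card_fccSlots])
    exact_mod_cast this
  have hrims : ∀ (G : E3 ≃ₗᵢ[ℝ] E3) (a b : ℝ), a ≤ 180 * ρ → b ≤ 144 * ρ → 0 ≤ a → 0 ≤ b →
      ((inPlaneRoots G 1).card : ℝ) * (220 * a + 220 * b) ≤ 855360 * ρ := by
    intro G a b ha hb ha0 hb0
    have h1 : 220 * a + 220 * b ≤ 71280 * ρ := by linarith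
    have h0 : (0 : ℝ) ≤ 220 * a + 220 * b := by linarith
    have h12 := hRT12 G
    have hc0 : (0 : ℝ) ≤ ((inPlaneRoots G 1).card : ℝ) := Nat.cast_nonneg _
    nlinarith
  have hrimsA := hrims Fr _ _ hrimT hrimB (Nat.cast_nonneg _) (Nat.cast_nonneg _)
  have hrimsB := hrims FrB _ _ hrimT' hrimB' (Nat.cast_nonneg _) (Nat.cast_nonneg _)
  -- ### family B: the mirrored export, pulled back to `X`
  obtain ⟨T', hcnt', hTpair', hTpay', hTwit'⟩ :=
    wordNet_barlow_endPairs_oneFccB ver hg hc hσ₁ (L₂.trans basalMirror) (L₁.trans basalMirror)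
      (basalMirror s₂ + cM) (basalMirror s₁ + cM) (Gf.trans basalMirror) hGf' hσ₂ ⟨G₀, ∅⟩ hG₀std FrB hFrB' hdozen'
      (Fr.trans basalMirror) hGt' htwin' X' (P₂.image M) (P₁.image M) R₀ h ρ hR₀ hρ hX'sep hP₁'X hP₂'X hP₁' hP₂'
  obtain ⟨T₂, hcard₂, hT₂pair, hT₂pay, hT₂shape, hT₂adm⟩ :=
    endPairs_pullback_mirror ver X cM hcMmirror Fr FrB hFrB T' hTpair' hTpay' hTwit'
  -- ### family A: the direct export
  obtain ⟨T₁, hcnt₁, hT₁pair, hT₁pay, hT₁wit⟩ := wordNet_barlow_endPairs_oneFcc ver hg hc hσ₁ L₁ L₂ s₁ s₂ Fr hFr Gf hGf hσ₂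
    hdozen X P₁ P₂ R₀ h ρ hR₀ hρ hX hP₁X hP₂X hP₁ hP₂
  -- ### the two-family row at the root frame `Fr`
  have hT₁pair' : ∀ bq ∈ T₁, bq.1 ∈ X ∧ bq.2 ∈ X ∧ -R₀ - 2 ≤ bq.1 2 ∧ bq.1 2 ≤ h + R₀ + 2 := by
    intro bq hbq
    obtain ⟨h1, h2, -, h4, h5⟩ := hT₁pair bq hbq
    exact ⟨h1, h2, by linarith, by linarith⟩
  have hT₂pair' : ∀ bq ∈ T₂, bq.1 ∈ X ∧ bq.2 ∈ X ∧ -R₀ - 2 ≤ bq.1 2 ∧ bq.1 2 ≤ h + R₀ + 2 := by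
    intro bq hbq
    obtain ⟨h1, h2, -, h4, h5⟩ := hT₂pair bq hbq
    rw [hc2] at h4 h5
    exact ⟨h1, h2, by linarith, by linarith⟩
  have hrowX := twoFamily_endPairs_le_row ver Fr hrow X hX (-R₀ - 2) (h + R₀ + 2) T₁ T₂ hT₁pair' hT₁pay hT₁wit hT₂pair'
    hT₂pay hT₂shape hT₂adm
  clear hT₁wit hT₁pay hT₂shape hT₂adm hT₂pay hTwit' hTpay' hTpair' hT₁pair hT₂pair hT₁pair' hT₂pair'
  -- ### the widened payer window in lane T's currency
  have hPAYWle := widePayers_le_payerSum hσ₁ hσ₂H L₁ L₂ s₁ s₂ X P₁ P₂ R₀ h ρ (by linarith) (by linarith) hX hP₁X hP₂X hcell hP₁ hP₂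
  -- (3) assemble
  have hA : _ := (Nat.cast_le (α := ℝ)).2 hcnt₁
  have hB : _ := (Nat.cast_le (α := ℝ)).2 hcnt'
  push_cast at hA hB
  have hcard₂' : (T₂.card : ℝ) = T'.card := by exact_mod_cast hcard₂
  have hmono := mul_le_mul_of_nonneg_left hPAYWle hsF
  rw [mul_add] at hmono
  have e1 : sF * (3456 * ρ) = 3456 * sF * ρ := by ring
  push_cast
  linarith [hrowX, hmono, hrimsA, hrimsB, e1, hA, hB, hcard₂']

end Summit.Ventures.Crystal3D.Theorems

end
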